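import Mathlib.LinearAlgebra.Dual.Lemmas
import Mathlib.Algebra.Field.ZMod
import Mathlib.Algebra.BigOperators.Pi
import Mathlib.Algebra.Group.Subgroup.Basic
import Mathlib.Tactic.Group
import Mathlib.Tactic.Abel
import Mathlib.Tactic.LinearCombination
import Summits.PneNP.PneNP.Theorems.ConvexRankGatesCaptureCentralCertificate
import HarnessLib

/-!
# Crux `Capture` (stmt-PneNP-2659), line `csp-spine-meet-to-join` rev 4 — the SPAN FORM of Theorem A

For a group with bilinear two-step coordinates `(x, z, β)` and coset-CSP data `(scope, H, c)`, the selected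
system is UNSATISFIABLE iff `(0, 1)` lies in the `𝔽₂`-span of the relation blocks `R j` (all affine relations
among the level-2 monomials of the top-layer bits and the central-layer bits valid on every solution of
constraint `j` alone). Soundness = evaluation; completeness = central certificate + quadratic section +
degree-2 division, taken as HYPOTHESES (closed propositions landed separately: `span_prep_lemmas`,
`span_prep_lemmas2`, `central_certificate`, `quad_section`, `stub_quadDivision`) so that this file needs
Mathlib only. Continuation lead c1, 2026-08-16. [folklore]
-/

namespace Summit.PneNP.PneNP.Cruxes.Capture.CspSpineMeetToJoin

set_option linter.dupNamespace false -- `Summit.PneNP.PneNP.…`: summit = sub-problem (D-0017)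

open Multiplicative

/-- **Theorem A in span form, hypothesis-passing version.** Hypotheses: `hQ` = `QuadDivision`
(`stub_quadDivision`), `hP2`–`hP3` ⊂ `span_prep_lemmas`, `hP4`–`hP5` = `span_prep_lemmas2`, `hsec` =
`quad_section` (`hQ` goes first: the elaborator times out otherwise); then the two-step coordinate laws; then
the coset data. The central certificate is imported. [folklore] -/
theorem twoStep_unsat_iff_span_of : ∀
    (hQ : ∀ (ι V : Type) [Fintype ι] [DecidableEq ι] [Fintype V]
      (e : V → ZMod 2 × (ι → ZMod 2)) (p : ZMod 2 × (ι → ZMod 2) × (ι × ι → ZMod 2)),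
      (∃ x : ι → ZMod 2, ∀ v, (e v).1 + ∑ i, (e v).2 i * x i = 0) →
      (∀ x : ι → ZMod 2, (∀ v, (e v).1 + ∑ i, (e v).2 i * x i = 0) →
        p.1 + ∑ i, p.2.1 i * x i + ∑ i, ∑ j, p.2.2 (i, j) * (x i * x j) = 0) →
      p ∈ Submodule.span (ZMod 2)
        (Set.range (fun v : V => ((e v).1, (e v).2, (0 : ι × ι → ZMod 2))) ∪
         Set.range (fun vi : V × ι => ((0 : ZMod 2), Pi.single vi.2 (e vi.1).1,
            fun ab : ι × ι => if ab.1 = vi.2 then (e vi.1).2 ab.2 else 0)) ∪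
         Set.range (fun i : ι => ((0 : ZMod 2), Pi.single i (1 : ZMod 2), Pi.single (i, i) (1 : ZMod 2))) ∪
         Set.range (fun ij : ι × ι => ((0 : ZMod 2), (0 : ι → ZMod 2),
            Pi.single ij (1 : ZMod 2) + Pi.single (ij.2, ij.1) (1 : ZMod 2)))))
    (hP2 : ∀ (Idx : Type) [Fintype Idx] (S : Set ((Idx → ZMod 2) × ZMod 2)),
      ((0 : Idx → ZMod 2), (1 : ZMod 2)) ∉ Submodule.span (ZMod 2) S →
      ∃ Y : Idx → ZMod 2, ∀ wb ∈ S, ∑ i, wb.1 i * Y i = wb.2)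
    (hP3 : ∀ (ι : Type) [Fintype ι] (A' : Set (ι → ZMod 2)), A'.Nonempty →
      (∀ u ∈ A', ∀ u' ∈ A', ∀ u'' ∈ A', u + u' + u'' ∈ A') → ∀ a ∉ A',
      ∃ e : ZMod 2 × (ι → ZMod 2), (∀ u ∈ A', e.1 + ∑ i, e.2 i * u i = 0) ∧ e.1 + ∑ i, e.2 i * a i ≠ 0)
    (hP4 : ∀ (nv l : ℕ) (θ : (Fin nv → Fin l → ZMod 2) →ₗ[ZMod 2] ZMod 2) (ζ : Fin nv → Fin l → ZMod 2),
      θ ζ = ∑ p : Fin nv × Fin l, θ (Pi.single p.1 (Pi.single p.2 1)) * ζ p.1 p.2)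
    (hP5 : ∀ (ι V : Type) [Fintype ι] [DecidableEq ι] [Fintype V] (e : V → ZMod 2 × (ι → ZMod 2))
      (a : ι → ZMod 2) (Y₂ : ι × ι → ZMod 2),
      (∀ v, (e v).1 + ∑ i, (e v).2 i * a i = 0) →
      (∀ v i, (e v).1 * a i + ∑ b, (e v).2 b * Y₂ (i, b) = 0) →
      (∀ i, a i + Y₂ (i, i) = 0) → (∀ i i', Y₂ (i, i') + Y₂ (i', i) = 0) →
      ∀ q ∈ Submodule.span (ZMod 2)
        (Set.range (fun v : V => ((e v).1, (e v).2, (0 : ι × ι → ZMod 2))) ∪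
         Set.range (fun vi : V × ι => ((0 : ZMod 2), Pi.single vi.2 (e vi.1).1,
            fun ab : ι × ι => if ab.1 = vi.2 then (e vi.1).2 ab.2 else 0)) ∪
         Set.range (fun i : ι => ((0 : ZMod 2), Pi.single i (1 : ZMod 2), Pi.single (i, i) (1 : ZMod 2))) ∪
         Set.range (fun ij : ι × ι => ((0 : ZMod 2), (0 : ι → ZMod 2),
            Pi.single ij (1 : ZMod 2) + Pi.single (ij.2, ij.1) (1 : ZMod 2)))),
        q.1 + ∑ i, q.2.1 i * a i + ∑ i, ∑ i', q.2.2 (i, i') * Y₂ (i, i') = 0)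
    (hsec : ∀ (ι : Type) [Fintype ι] [DecidableEq ι] (A : Set (ι → ZMod 2)) (φ : (ι → ZMod 2) → ZMod 2)
      (B : (ι → ZMod 2) → (ι → ZMod 2) → ZMod 2),
      (∀ d₁ d₂ d' : ι → ZMod 2, B (d₁ + d₂) d' = B d₁ d' + B d₂ d') →
      (∀ d d₁' d₂' : ι → ZMod 2, B d (d₁' + d₂') = B d d₁' + B d d₂') → A.Nonempty →
      (∀ u ∈ A, ∀ u' ∈ A, ∀ u'' ∈ A, u + u' + u'' ∈ A) →
      (∀ u ∈ A, ∀ d d' : ι → ZMod 2, u + d ∈ A → u + d' ∈ A →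
        φ (u + d + d') + φ (u + d) + φ (u + d') + φ u = B d d') →
      ∃ (f₀ : ZMod 2) (f₁ : ι → ZMod 2) (f₂ : ι × ι → ZMod 2),
        ∀ u ∈ A, φ u = f₀ + ∑ i, f₁ i * u i + ∑ i, ∑ j, f₂ (i, j) * (u i * u j))
    (G : Type) [Group G] (k l : ℕ) (x : G → Fin k → ZMod 2) (z : G → Fin l → ZMod 2)
    (β : (Fin k → ZMod 2) → (Fin k → ZMod 2) → Fin l → ZMod 2)
    (hbij : Function.Bijective (fun g => (x g, z g))) (hx : ∀ g h, x (g * h) = x g + x h)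
    (hz : ∀ g h, z (g * h) = z g + z h + β (x g) (x h))
    (hβl : ∀ a a' b, β (a + a') b = β a b + β a' b) (hβr : ∀ a b b', β a (b + b') = β a b + β a b')
    (nv m : ℕ) (r : Fin m → ℕ) (scope : (j : Fin m) → Fin (r j) → Fin nv)
    (H : (j : Fin m) → Subgroup (Fin (r j) → G)) (c : (j : Fin m) → Fin (r j) → G) (v : Fin m → Bool),
    let Idx : Type := (Fin nv × Fin k) ⊕ ((Fin nv × Fin k) × (Fin nv × Fin k)) ⊕ (Fin nv × Fin l)
    let Yv : (Fin nv → G) → Idx → ZMod 2 := fun h => Sum.elim (fun p => x (h p.1) p.2)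
      (Sum.elim (fun pq => x (h pq.1.1) pq.1.2 * x (h pq.2.1) pq.2.2) (fun p => z (h p.1) p.2))
    let R : Fin m → Set ((Idx → ZMod 2) × ZMod 2) := fun j => {wb | ∀ h : Fin nv → G,
      (c j)⁻¹ * (fun i => h (scope j i)) ∈ H j → ∑ i, wb.1 i * Yv h i = wb.2}
    (¬ ∃ h : Fin nv → G, ∀ j, v j = true → (c j)⁻¹ * (fun i => h (scope j i)) ∈ H j) ↔
      ((0 : Idx → ZMod 2), (1 : ZMod 2)) ∈ Submodule.span (ZMod 2) (⋃ j ∈ {j | v j = true}, R j) := by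
  have sq2 : ∀ t : ZMod 2, t * t = t := by decide
  have dbl : ∀ t : ZMod 2, t + t = 0 := by decide
  have neg2 : ∀ t : ZMod 2, -t = t := by decide
  have absorb : ∀ a b t : ZMod 2, a + b + (t + a + b) = t := by decide
  intro hQ hP2 hP3 hP4 hP5 hsec G _ k l x z β hbij hx hz hβl hβr nv m r scope H c v Idx Yv R
  classical
  haveI : Fact (Nat.Prime 2) := ⟨Nat.prime_two⟩
  refine ⟨fun hunsat => ?_, fun hmem ⟨h, hh⟩ => ?_⟩
  swap
  · let L : ((Idx → ZMod 2) × ZMod 2) →ₗ[ZMod 2] ZMod 2 :=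
      { toFun := fun wb => ∑ i, wb.1 i * Yv h i + wb.2
        map_add' := fun a b => by
          simp only [Prod.fst_add, Prod.snd_add, Pi.add_apply, add_mul, Finset.sum_add_distrib]; abel
        map_smul' := fun t a => by
          simp only [Prod.smul_fst, Prod.smul_snd, Pi.smul_apply, smul_eq_mul, RingHom.id_apply, Finset.mul_sum,
            mul_add, mul_assoc] }
    have hker : (⋃ j ∈ {j | v j = true}, R j) ⊆ (LinearMap.ker L : Set _) := fun wb hwb => by
      simp only [Set.mem_iUnion, Set.mem_setOf_eq] at hwb
      obtain ⟨j, hj, hwb⟩ := hwb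
      simp only [SetLike.mem_coe, LinearMap.mem_ker, L, LinearMap.coe_mk, AddHom.coe_mk, hwb h (hh j hj), dbl]
    simpa [L] using (Submodule.span_le.2 hker) hmem
  by_contra hsp
  obtain ⟨Y, hY'⟩ := hP2 Idx (⋃ j ∈ {j | v j = true}, R j) hsp
  have hY : ∀ j, v j = true → ∀ wb ∈ R j, ∑ i, wb.1 i * Y i = wb.2 := fun j hj wb hwb =>
    hY' wb (Set.mem_biUnion hj hwb)
  set E : G ≃ (Fin k → ZMod 2) × (Fin l → ZMod 2) := Equiv.ofBijective _ hbij with hE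
  have hEx : ∀ a w, x (E.symm (a, w)) = a := fun a w => by
    have := E.apply_symm_apply (a, w); rw [hE, Equiv.ofBijective_apply] at this; exact congrArg Prod.fst this
  have hEz : ∀ a w, z (E.symm (a, w)) = w := fun a w => by
    have := E.apply_symm_apply (a, w); rw [hE, Equiv.ofBijective_apply] at this; exact congrArg Prod.snd this
  have hinj : ∀ g h : G, x g = x h → z g = z h → g = h := fun g h h1 h2 =>
    hbij.1 (Prod.ext h1 h2)
  have cancel2 : ∀ {α : Type} [AddGroup α] (t : α), t = t + t → t = 0 := fun t h =>
    (add_left_cancel (a := t) (by rw [add_zero]; exact h)).symm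
  have hβ0l : ∀ b, β 0 b = 0 := fun b => cancel2 _ (by have := hβl 0 0 b; rwa [add_zero] at this)
  have hβ0r : ∀ a, β a 0 = 0 := fun a => cancel2 _ (by have := hβr a 0 0; rwa [add_zero] at this)
  have hx1 : x 1 = 0 := cancel2 _ (by have := hx 1 1; rwa [mul_one] at this)
  have hxinv : ∀ g : G, x g⁻¹ = x g := fun g => by
    have := hx g g⁻¹; rw [mul_inv_cancel, hx1] at this
    rw [eq_neg_of_add_eq_zero_right this.symm]; funext i; exact (ZMod.neg_eq_self_mod_two _)
  let Zadd := Fin nv → Fin l → ZMod 2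
  let eP : Multiplicative Zadd →* (Fin nv → G) :=
    { toFun := fun ζ s => E.symm (0, Multiplicative.toAdd ζ s)
      map_one' := by
        funext s; apply hinj
        · rw [hEx, Pi.one_apply, hx1]
        · rw [hEz, Pi.one_apply]; exact (cancel2 _ (by have := hz 1 1; rwa [mul_one, hx1, hβ0l, add_zero] at this)).symm
      map_mul' := fun a b => by
        funext s; apply hinj
        · rw [hEx, Pi.mul_apply, hx, hEx, hEx, add_zero]
        · rw [hEz, Pi.mul_apply, hz, hEz, hEz, hEx, hβ0l, add_zero]; rfl }
  have heP : ∀ (ζ : Zadd) s, eP (ofAdd ζ) s = E.symm (0, ζ s) := fun _ _ => rfl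
  have hcen : ∀ ζ, eP ζ ∈ Subgroup.center (Fin nv → G) := fun ζ => by
    rw [Subgroup.mem_center_iff]; intro g; funext s; apply hinj
    · rw [Pi.mul_apply, Pi.mul_apply, hx, hx, add_comm]
    · rw [Pi.mul_apply, Pi.mul_apply, hz, hz]
      show z (g s) + z (E.symm (0, toAdd ζ s)) + β (x (g s)) (x (E.symm (0, toAdd ζ s))) =
        z (E.symm (0, toAdd ζ s)) + z (g s) + β (x (E.symm (0, toAdd ζ s))) (x (g s))
      rw [hEx, hβ0l, hβ0r, add_zero, add_zero, add_comm]
  let xf : (Fin nv → G) → (Fin nv × Fin k) → ZMod 2 := fun h p => x (h p.1) p.2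
  let zf : (Fin nv → G) → Zadd := fun h s => z (h s)
  have hxf_mul : ∀ g h, xf (g * h) = xf g + xf h := fun g h => by
    funext p; simp only [xf, Pi.mul_apply, hx, Pi.add_apply]
  have hxf_inv : ∀ g, xf g⁻¹ = xf g := fun g => by funext p; simp only [xf, Pi.inv_apply, hxinv]
  have hzf_mul : ∀ g h, zf (g * h) = zf g + zf h + fun s => β (x (g s)) (x (h s)) := fun g h => by
    funext s; simp only [zf, Pi.mul_apply, hz]; rfl
  have hxf_e : ∀ ζ : Zadd, xf (eP (ofAdd ζ)) = 0 := fun ζ => by funext p; simp only [xf, heP, hEx]; rfl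
  have hzf_e : ∀ ζ : Zadd, zf (eP (ofAdd ζ)) = ζ := fun ζ => by funext s; simp only [zf, heP, hEz]
  let X : ((Fin nv × Fin k) → ZMod 2) → (Fin nv → G) := fun u s => E.symm (fun i => u (s, i), 0)
  have hxf_X : ∀ u, xf (X u) = u := fun u => by funext p; simp only [xf, X, hEx]
  have hzf_X : ∀ u, zf (X u) = 0 := fun u => by funext s; simp only [zf, X, hEz]; rfl
  have hlift : ∀ h : Fin nv → G, h = X (xf h) * eP (ofAdd (zf h)) := fun h => by
    funext s; apply hinj
    · rw [Pi.mul_apply, hx, heP, hEx, hEx, add_zero]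
    · simp only [Pi.mul_apply, hz, heP, X, hEz, hEx, hβ0r, add_zero, zero_add]; rfl
  have hYv : ∀ (h : Fin nv → G) (wb : (Idx → ZMod 2) × ZMod 2), ∑ i, wb.1 i * Yv h i =
      ∑ p, wb.1 (Sum.inl p) * xf h p + ∑ pq, wb.1 (Sum.inr (Sum.inl pq)) * (xf h pq.1 * xf h pq.2) +
        ∑ p, wb.1 (Sum.inr (Sum.inr p)) * zf h p.1 p.2 := by
    intro h wb
    simp only [Idx, Fintype.sum_sum_type, Yv, Sum.elim_inl, Sum.elim_inr, add_assoc]; rfl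
  set C : Fin m → Set (Fin nv → G) := fun j => {h | (c j)⁻¹ * (fun i => h (scope j i)) ∈ H j} with hC
  have hCne : ∀ j, v j = true → (C j).Nonempty := fun j hj => by
    by_contra hne
    rw [Set.not_nonempty_iff_eq_empty] at hne
    refine hsp (Submodule.subset_span (Set.mem_biUnion hj fun h (hh : h ∈ C j) => ?_))
    rw [hne] at hh; exact hh.elim
  have hC3 : ∀ j (h₁ h₂ h₃ : Fin nv → G), h₁ ∈ C j → h₂ ∈ C j → h₃ ∈ C j → h₁ * h₂⁻¹ * h₃ ∈ C j := by
    intro j h₁ h₂ h₃ hh₁ hh₂ hh₃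
    have e : (c j)⁻¹ * (fun i => (h₁ * h₂⁻¹ * h₃) (scope j i)) =
        ((c j)⁻¹ * fun i => h₁ (scope j i)) * ((c j)⁻¹ * fun i => h₂ (scope j i))⁻¹ *
          ((c j)⁻¹ * fun i => h₃ (scope j i)) := by
      funext i; simp only [Pi.mul_apply, Pi.inv_apply]; group
    show _ ∈ H j; rw [e]; exact (H j).mul_mem ((H j).mul_mem hh₁ ((H j).inv_mem hh₂)) hh₃
  let A : Fin m → Set ((Fin nv × Fin k) → ZMod 2) := fun j => {u | ∃ h ∈ C j, xf h = u}
  have hA3 : ∀ j, ∀ u ∈ A j, ∀ u' ∈ A j, ∀ u'' ∈ A j, u + u' + u'' ∈ A j := by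
    rintro j u ⟨h, hh, rfl⟩ u' ⟨h', hh', rfl⟩ u'' ⟨h'', hh'', rfl⟩
    exact ⟨h * h'⁻¹ * h'', hC3 j h h' h'' hh hh' hh'', by rw [hxf_mul, hxf_mul, hxf_inv]⟩
  have hsep := hP3 (Fin nv × Fin k)
  have hformR : ∀ j (e : ZMod 2 × ((Fin nv × Fin k) → ZMod 2)), (∀ u ∈ A j, e.1 + ∑ i, e.2 i * u i = 0) →
      ((Sum.elim e.2 0 : Idx → ZMod 2), e.1) ∈ R j := by
    intro j e he h hh; rw [hYv]
    simp only [Sum.elim_inl, Sum.elim_inr, Pi.zero_apply, zero_mul, Finset.sum_const_zero, add_zero]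
    have := he (xf h) ⟨h, hh, rfl⟩
    calc ∑ p, e.2 p * xf h p = e.1 + ∑ p, e.2 p * xf h p + e.1 := by rw [add_comm e.1, add_assoc, dbl, add_zero]
      _ = e.1 := by rw [this, zero_add]
  set â : (Fin nv × Fin k) → ZMod 2 := fun p => Y (Sum.inl p) with hâ
  have hâA : ∀ j, v j = true → â ∈ A j := fun j hj => by
    by_contra hna
    obtain ⟨e, he, hea⟩ := hsep (A j) (let ⟨h, hh⟩ := hCne j hj; ⟨xf h, h, hh, rfl⟩) (hA3 j) â hna
    have := hY j hj _ (hformR j e he)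
    simp only [Idx, Fintype.sum_sum_type, Sum.elim_inl, Sum.elim_inr, Pi.zero_apply, zero_mul,
      Finset.sum_const_zero, add_zero] at this
    exact hea (by rw [this, dbl])
  let ρ : (j : Fin m) → (Fin nv → G) →* (Fin (r j) → G) := fun j =>
    { toFun := fun h i => h (scope j i), map_one' := rfl, map_mul' := fun _ _ => rfl }
  let Hs : {j : Fin m // v j = true} → Subgroup (Fin nv → G) := fun j => (H j.1).comap (ρ j.1)
  have hg : ∀ j : {j : Fin m // v j = true}, ∃ g, g ∈ C j.1 := fun j => hCne j.1 j.2
  choose g hgC using hg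
  have hmemC : ∀ (j : {j : Fin m // v j = true}) (y : Fin nv → G), y ∈ C j.1 ↔ (g j)⁻¹ * y ∈ Hs j := fun j y => by
    have hgj := hgC j
    change (c j.1)⁻¹ * ρ j.1 (g j) ∈ H j.1 at hgj
    change (c j.1)⁻¹ * ρ j.1 y ∈ H j.1 ↔ ρ j.1 ((g j)⁻¹ * y) ∈ H j.1
    have e : ((c j.1)⁻¹ * ρ j.1 (g j))⁻¹ * ((c j.1)⁻¹ * ρ j.1 y) = ρ j.1 ((g j)⁻¹ * y) := by
      rw [map_mul, map_inv, mul_inv_rev, inv_inv, mul_assoc, mul_inv_cancel_left]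
    rw [← e]; exact ⟨fun h => (H j.1).mul_mem ((H j.1).inv_mem hgj) h, fun h => by simpa using (H j.1).mul_mem hgj h⟩
  have hAlift : ∀ (j : {j : Fin m // v j = true}) (u : (Fin nv × Fin k) → ZMod 2), u ∈ A j.1 →
      ∃ ζ : Zadd, X u * eP (ofAdd ζ) ∈ C j.1 := by
    rintro j u ⟨h, hh, rfl⟩; exact ⟨zf h, by rw [← hlift h]; exact hh⟩
  have hζ := fun j : {j : Fin m // v j = true} => hAlift j â (hâA j.1 j.2)
  choose ζ₀ hζ₀ using hζ
  have hunsat' : ¬ ∃ y : Fin nv → G, ∀ j : {j : Fin m // v j = true}, (g j)⁻¹ * y ∈ Hs j := by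
    rintro ⟨y, hy⟩; exact hunsat ⟨y, fun j hj => (hmemC ⟨j, hj⟩ y).2 (hy ⟨j, hj⟩)⟩
  obtain ⟨θ, hθa, hθb, hθc⟩ := central_certificate eP Hs hcen g (X â) (fun j => (g j)⁻¹ * (X â * eP (ofAdd (ζ₀ j))))
    (fun j => -ζ₀ j) (fun j => (hmemC j _).1 (hζ₀ j)) (fun j => by
      rw [mul_inv_cancel_left, mul_assoc, ← map_mul, ← ofAdd_add, add_neg_cancel, ofAdd_zero, map_one,
        mul_one]) hunsat'
  have hφwd : ∀ (j : {j : Fin m // v j = true}) (h h' : Fin nv → G), h ∈ C j.1 → h' ∈ C j.1 → xf h = xf h' →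
      θ j (zf h) = θ j (zf h') := by
    intro j h h' hh hh' hxe
    have hd : h⁻¹ * h' = eP (ofAdd (zf h' - zf h)) := by
      conv_lhs => rw [hlift h, hlift h', hxe]
      rw [mul_inv_rev, mul_assoc, inv_mul_cancel_left, ← map_inv, ← map_mul, ← ofAdd_neg, ← ofAdd_add,
        neg_add_eq_sub]
    have hmem : eP (ofAdd (zf h' - zf h)) ∈ Hs j := by
      rw [← hd, show h⁻¹ * h' = ((g j)⁻¹ * h)⁻¹ * ((g j)⁻¹ * h') by group]
      exact (Hs j).mul_mem ((Hs j).inv_mem ((hmemC j h).1 hh)) ((hmemC j h').1 hh')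
    have := hθa j _ hmem; rw [map_sub, sub_eq_zero] at this; exact this.symm
  have hquad : ∀ j : {j : Fin m // v j = true}, ∃ (f₀ : ZMod 2) (f₁ : (Fin nv × Fin k) → ZMod 2)
      (f₂ : (Fin nv × Fin k) × (Fin nv × Fin k) → ZMod 2), ∀ h ∈ C j.1,
      θ j (zf h) = f₀ + ∑ i, f₁ i * xf h i + ∑ pq, f₂ pq * (xf h pq.1 * xf h pq.2) := by
    intro j
    let φ : ((Fin nv × Fin k) → ZMod 2) → ZMod 2 := fun u =>
      if hu : ∃ h ∈ C j.1, xf h = u then θ j (zf (Classical.choose hu)) else 0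
    have hφ : ∀ h ∈ C j.1, φ (xf h) = θ j (zf h) := fun h hh => by
      have hu : ∃ h' ∈ C j.1, xf h' = xf h := ⟨h, hh, rfl⟩
      simp only [φ, dif_pos hu]; exact hφwd j _ _ (Classical.choose_spec hu).1 hh (Classical.choose_spec hu).2
    let B : ((Fin nv × Fin k) → ZMod 2) → ((Fin nv × Fin k) → ZMod 2) → ZMod 2 := fun d d' =>
      θ j (fun s => β (fun i => d (s, i)) (fun i => d' (s, i)))
    obtain ⟨f₀, f₁, f₂, hf⟩ := hsec (Fin nv × Fin k) (A j.1) φ B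
      (fun d₁ d₂ d' => by simp only [B, ← map_add]; congr 1; funext s; exact hβl _ _ _)
      (fun d d₁' d₂' => by simp only [B, ← map_add]; congr 1; funext s; exact hβr _ _ _)
      ⟨xf (g j), g j, hgC j, rfl⟩ (hA3 j.1) (by
        rintro u ⟨h₀, hh₀, rfl⟩ d d' ⟨h₁, hh₁, he₁⟩ ⟨h₂, hh₂, he₂⟩
        set w := h₀⁻¹ * h₁ with hw0
        set w' := h₀⁻¹ * h₂ with hw0'
        have hw : xf w = d := by
          rw [hw0, hxf_mul, hxf_inv, he₁]; funext i; simp only [Pi.add_apply]; linear_combination dbl (xf h₀ i)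
        have hw' : xf w' = d' := by
          rw [hw0', hxf_mul, hxf_inv, he₂]; funext i; simp only [Pi.add_apply]; linear_combination dbl (xf h₀ i)
        have e1 : h₁ = h₀ * w := by rw [hw0]; group
        have e2 : h₂ = h₀ * w' := by rw [hw0']; group
        have h3 : h₀ * w * w' ∈ C j.1 := by
          have := hC3 j.1 h₁ h₀ h₂ hh₁ hh₀ hh₂; rwa [show h₁ * h₀⁻¹ * h₂ = h₀ * w * w' by rw [hw0, hw0']; group] at this
        have hs3 : xf (h₀ * w * w') = xf h₀ + d + d' := by rw [hxf_mul, hxf_mul, hw, hw']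
        rw [← hs3, hφ _ h3, ← he₁, hφ _ hh₁, ← he₂, hφ _ hh₂, hφ _ hh₀, e1, e2]
        have key : ∀ s t, zf (h₀ * w * w') s t + zf (h₀ * w) s t + zf (h₀ * w') s t + zf h₀ s t =
            β (fun i => d (s, i)) (fun i => d' (s, i)) t := by
          intro s t
          have hxw : x (w s) = fun i => d (s, i) := by rw [← hw]
          have hxw' : x (w' s) = fun i => d' (s, i) := by rw [← hw']
          simp only [zf, Pi.mul_apply, hz, hx, hβl, Pi.add_apply, hxw, hxw']
          linear_combination (2 : ZMod 2) * dbl (z (h₀ s) t) + dbl (z (w s) t) + dbl (z (w' s) t) +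
            dbl (β (x (h₀ s)) (fun i => d (s, i)) t) + dbl (β (x (h₀ s)) (fun i => d' (s, i)) t)
        rw [← map_add, ← map_add, ← map_add]; show θ j _ = θ j _; congr 1; funext s t; exact key s t)
    exact ⟨f₀, f₁, f₂, fun h hh => by
      rw [← hφ h hh, hf _ ⟨h, hh, rfl⟩, ← Fintype.sum_prod_type' (f := fun i i' => f₂ (i, i') * (xf h i * xf h i'))]⟩
  choose f₀ f₁ f₂ hf using hquad
  have hrow : ∀ j : {j : Fin m // v j = true}, ((Sum.elim (f₁ j) (Sum.elim (f₂ j)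
      (fun p : Fin nv × Fin l => θ j (Pi.single p.1 (Pi.single p.2 1)))) : Idx → ZMod 2), f₀ j) ∈ R j.1 := by
    intro j h hh; rw [hYv]; simp only [Sum.elim_inl, Sum.elim_inr]
    rw [← hP4 nv l (θ j) (zf h), hf j h hh]; exact absorb _ _ _
  have hE : ∀ j : {j : Fin m // v j = true}, ∑ p, f₁ j p * Y (Sum.inl p) +
      (∑ pq, f₂ j pq * Y (Sum.inr (Sum.inl pq)) +
        ∑ p : Fin nv × Fin l, θ j (Pi.single p.1 (Pi.single p.2 1)) * Y (Sum.inr (Sum.inr p))) = f₀ j :=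
    fun j => by simpa only [Idx, Fintype.sum_sum_type, Sum.elim_inl, Sum.elim_inr, add_assoc] using hY j.1 j.2 _ (hrow j)
  have hdag : ∑ j : {j : Fin m // v j = true}, (f₀ j + ∑ p, f₁ j p * Y (Sum.inl p) +
      ∑ pq, f₂ j pq * Y (Sum.inr (Sum.inl pq))) = 0 := by
    have h3 : ∑ j : {j : Fin m // v j = true}, ∑ p : Fin nv × Fin l,
        θ j (Pi.single p.1 (Pi.single p.2 1)) * Y (Sum.inr (Sum.inr p)) = 0 := by
      rw [Finset.sum_comm]
      exact Finset.sum_eq_zero fun p _ => by rw [← Finset.sum_mul, hθb, zero_mul]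
    have hs := Finset.sum_congr rfl fun (j : {j : Fin m // v j = true}) (_ : j ∈ Finset.univ) => hE j
    rw [Finset.sum_add_distrib, Finset.sum_add_distrib, h3, add_zero] at hs
    rw [Finset.sum_add_distrib, Finset.sum_add_distrib, add_assoc, hs, dbl]
  have hddag : ∀ u, (∀ j : {j : Fin m // v j = true}, u ∈ A j.1) →
      ∑ j : {j : Fin m // v j = true}, (f₀ j + ∑ p, f₁ j p * u p + ∑ pq, f₂ j pq * (u pq.1 * u pq.2)) = 1 := by
    intro u hu
    choose ζu hζu using fun j => hAlift j u (hu j)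
    refine (Finset.sum_congr rfl fun j _ => ?_).trans (hθc (X u) (fun j => (g j)⁻¹ * (X u * eP (ofAdd (ζu j))))
      (fun j => -ζu j) (fun j => (hmemC j _).1 (hζu j)) (fun j => by
        rw [mul_inv_cancel_left, mul_assoc, ← map_mul, ← ofAdd_add, add_neg_cancel, ofAdd_zero, map_one,
          mul_one]))
    have h2 := hf j _ (hζu j)
    have h3 : (fun s => β (x (X u s)) (x (eP (ofAdd (ζu j)) s))) = 0 := by
      funext s; rw [heP, hEx, hEx, hβ0r]; rfl
    rw [hzf_mul, hxf_mul, hzf_X, hxf_X, hzf_e, hxf_e, add_zero, zero_add, h3, add_zero] at h2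
    show _ = θ j (-ζu j); rw [map_neg, neg2, h2]
  have hnorm : ∀ (a₁ : (Fin nv × Fin k) → ZMod 2) (a₂ : (Fin nv × Fin k) × (Fin nv × Fin k) → ZMod 2),
      (∑ j : {j : Fin m // v j = true}, f₀ j) + ∑ i, (∑ j : {j : Fin m // v j = true}, f₁ j) i * a₁ i +
        ∑ pq, (∑ j : {j : Fin m // v j = true}, f₂ j) pq * a₂ pq =
        ∑ j : {j : Fin m // v j = true}, (f₀ j + ∑ i, f₁ j i * a₁ i + ∑ pq, f₂ j pq * a₂ pq) := by
    intro a₁ a₂; simp only [Finset.sum_apply, Finset.sum_mul, Finset.sum_add_distrib]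
    rw [Finset.sum_comm (f := fun i j => f₁ j i * a₁ i), Finset.sum_comm (f := fun pq j => f₂ j pq * a₂ pq)]
  let V : Type := Σ j : {j : Fin m // v j = true},
    {e : ZMod 2 × ((Fin nv × Fin k) → ZMod 2) // ∀ u ∈ A j.1, e.1 + ∑ i, e.2 i * u i = 0}
  have hVA : ∀ u : (Fin nv × Fin k) → ZMod 2, (∀ ve : V, (ve.2.1).1 + ∑ i, (ve.2.1).2 i * u i = 0) →
      ∀ j : {j : Fin m // v j = true}, u ∈ A j.1 := fun u hu j => by
    by_contra hna; obtain ⟨e, he, hea⟩ := hsep (A j.1) ⟨xf (g j), g j, hgC j, rfl⟩ (hA3 j.1) u hna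
    exact hea (hu ⟨j, e, he⟩)
  have hq := hQ (Fin nv × Fin k) V (fun ve => ve.2.1)
    ((∑ j : {j : Fin m // v j = true}, f₀ j) + 1, ∑ j : {j : Fin m // v j = true}, f₁ j,
      ∑ j : {j : Fin m // v j = true}, f₂ j)
    ⟨â, fun ve => ve.2.2 â (hâA _ ve.1.2)⟩ (fun u hu => by
      show (∑ j : {j : Fin m // v j = true}, f₀ j) + 1 + ∑ i, (∑ j : {j : Fin m // v j = true}, f₁ j) i * u i +
        ∑ i, ∑ i', (∑ j : {j : Fin m // v j = true}, f₂ j) (i, i') * (u i * u i') = 0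
      rw [← Fintype.sum_prod_type' (f := fun i i' => (∑ j : {j : Fin m // v j = true}, f₂ j) (i, i') * (u i * u i'))]
      have := hnorm u (fun pq => u pq.1 * u pq.2)
      rw [hddag u (hVA u hu)] at this
      linear_combination this + dbl 1)
  have hRY : ∀ (j : {j : Fin m // v j = true}) (W : Idx → ZMod 2) (b : ZMod 2),
      (∀ h ∈ C j.1, ∑ i, W i * Yv h i = b) → ∑ i, W i * Y i = b := fun j W b hW => hY j.1 j.2 (W, b) hW
  obtain ⟨j₀⟩ : Nonempty {j : Fin m // v j = true} := by
    by_contra hne; exact hunsat ⟨1, fun j hj => (hne ⟨⟨j, hj⟩⟩).elim⟩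
  have hgenY : ∀ h : Fin nv → G, ∀ idx, Yv h idx = Sum.elim (xf h) (Sum.elim (fun pq => xf h pq.1 * xf h pq.2)
      (fun p => zf h p.1 p.2)) idx := by
    rintro h (p | pq | p) <;> rfl
  have h2' : ∀ (ve : V) (i : Fin nv × Fin k),
      (ve.2.1).1 * Y (Sum.inl i) + ∑ b, (ve.2.1).2 b * Y (Sum.inr (Sum.inl (i, b))) = 0 := by
    rintro ⟨j, e, he⟩ i
    have hshape : ∀ Z : Idx → ZMod 2, ∑ idx, (Sum.elim (Pi.single i e.1)
        (Sum.elim (fun ab : (Fin nv × Fin k) × (Fin nv × Fin k) => if ab.1 = i then e.2 ab.2 else 0) 0) :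
          Idx → ZMod 2) idx * Z idx = e.1 * Z (Sum.inl i) + ∑ b, e.2 b * Z (Sum.inr (Sum.inl (i, b))) := by
      intro Z
      simp only [Idx, Fintype.sum_sum_type, Sum.elim_inl, Sum.elim_inr, Pi.zero_apply, zero_mul,
        Finset.sum_const_zero, add_zero, Pi.single_apply, ite_mul, Finset.sum_ite_eq', Finset.mem_univ,
        if_true]
      rw [Fintype.sum_prod_type, Finset.sum_eq_single i (fun a _ ha => by simp [ha]) (by simp)]
      simp
    have := hRY ⟨j, by exact j.2⟩ _ 0 (fun h hh => by
      rw [hshape]; simp only [hgenY, Sum.elim_inl, Sum.elim_inr]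
      have h0 : e.1 + ∑ b, e.2 b * xf h b = 0 := he (xf h) ⟨h, hh, rfl⟩
      calc e.1 * xf h i + ∑ b, e.2 b * (xf h i * xf h b) = xf h i * (e.1 + ∑ b, e.2 b * xf h b) := by
            rw [mul_add, Finset.mul_sum, mul_comm]
            exact congrArg _ (Finset.sum_congr rfl fun b _ => by ring)
        _ = 0 := by rw [h0, mul_zero])
    rwa [hshape] at this
  have h3' : ∀ i : Fin nv × Fin k, Y (Sum.inl i) + Y (Sum.inr (Sum.inl (i, i))) = 0 := by
    intro i
    have hshape : ∀ Z : Idx → ZMod 2, ∑ idx, (Sum.elim (Pi.single i 1)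
        (Sum.elim (Pi.single (i, i) 1) 0) : Idx → ZMod 2) idx * Z idx = Z (Sum.inl i) + Z (Sum.inr (Sum.inl (i, i))) := by
      intro Z
      simp only [Idx, Fintype.sum_sum_type, Sum.elim_inl, Sum.elim_inr, Pi.zero_apply, zero_mul,
        Finset.sum_const_zero, add_zero, Pi.single_apply, ite_mul, one_mul, Finset.sum_ite_eq',
        Finset.mem_univ, if_true]
    have := hRY j₀ _ 0 (fun h _ => by
      rw [hshape]; simp only [hgenY, Sum.elim_inl, Sum.elim_inr]; rw [sq2, dbl])
    rwa [hshape] at this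
  have h4' : ∀ i i' : Fin nv × Fin k, Y (Sum.inr (Sum.inl (i, i'))) + Y (Sum.inr (Sum.inl (i', i))) = 0 := by
    intro i i'
    have hshape : ∀ Z : Idx → ZMod 2, ∑ idx, (Sum.elim 0 (Sum.elim (Pi.single (i, i') 1 +
        Pi.single (i', i) 1) 0) : Idx → ZMod 2) idx * Z idx =
          Z (Sum.inr (Sum.inl (i, i'))) + Z (Sum.inr (Sum.inl (i', i))) := by
      intro Z
      simp only [Idx, Fintype.sum_sum_type, Sum.elim_inl, Sum.elim_inr, Pi.zero_apply, zero_mul,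
        Finset.sum_const_zero, add_zero, zero_add, Pi.add_apply, add_mul, Finset.sum_add_distrib,
        Pi.single_apply, ite_mul, one_mul, Finset.sum_ite_eq', Finset.mem_univ, if_true]
    have := hRY j₀ _ 0 (fun h _ => by
      rw [hshape]; simp only [hgenY, Sum.elim_inl, Sum.elim_inr]; rw [mul_comm, dbl])
    rwa [hshape] at this
  have hfin := hP5 (Fin nv × Fin k) V (fun ve => ve.2.1) â (fun pq => Y (Sum.inr (Sum.inl pq)))
    (fun ve => ve.2.2 â (hâA _ ve.1.2)) h2' h3' h4' _ hq
  rw [← Fintype.sum_prod_type' (f := fun i i' =>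
    (∑ j : {j : Fin m // v j = true}, f₂ j) (i, i') * Y (Sum.inr (Sum.inl (i, i'))))] at hfin
  have := hnorm â (fun pq => Y (Sum.inr (Sum.inl pq))); rw [hdag] at this
  exact one_ne_zero (by linear_combination hfin - this : (1 : ZMod 2) = 0)

end Summit.PneNP.PneNP.Cruxes.Capture.CspSpineMeetToJoin
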